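import Summits.NavierStokesRegularity.NavierStokesRegularity.Theorems.ScenarioCensusSteady
import Summits.NavierStokesRegularity.NavierStokesRegularity.Theorems.ScenarioCensusPeriodicSlabSwirlLiouville
import Summits.NavierStokesRegularity.NavierStokesRegularity.Theorems.ScenarioCensusPeriodicSlabRadialLiouville
import HarnessLib

/-!
# Blow-up scenario census, block S: sub-rows S7a / S7b of row S7 (Bang–Gui–Wang–Xie 2025,
# Thm 1.4 (a), (b)) — typed and EXCLUDED-IN-TREE (leaf)

Cell `pub/ns-census` (director-ns KEY req102, D-0154 (A)), typer seat `ns-census-typer-2` (generation 7).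
Row S7 of the census (`ScenarioCensusSteady.lean`, Appendix 4) is the composite Literature fact
`BangGuiWangXie2025_periodicSlab_liouville` (J. Fluid Mech. 1005 (2025) A6 = arXiv:2205.13259,
Thm 1.4: bounded smooth steady Navier–Stokes flows on `ℝ³`, axially `L`-periodic; (a) `u^θ`
independent of `θ` ∨ (b) `u^r` independent of `θ` ∨ (c) `r u^r → 0` ⇒ `U ≡ c e₃`; (d)
`sup ‖U‖ < 2πν/L` ⇒ constant). Case (d) is the row `Row_S7d` (EXCLUDED-IN-TREE,
`row_S7d_excluded`). This leaf types the cases (a) and (b) separately, each VERBATIM the fact's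
binders with the corresponding disjunct as hypothesis, and closes them BY NAME by the tree theorems
`PeriodicSlab.periodicSlab_liouville_swirlAxisymmetric` / `…_radialAxisymmetric`
(`ScenarioCensusPeriodicSlab{Swirl,Radial}Liouville.lean`, on the S6 chain: periodic pressure,
zero vertical means of the radial velocity, Poincaré–Wirtinger, foot-point pressure splitting,
dyadic Saint-Venant; for (b) also the angular mean of `PineauVicolAngularMean`). Case (c) is NOT
proved in the tree; the composite `Row_S7` stays PRINT. No summit statement is proved.
-/

-- the summit and its single problem share the name (D-0017 nested layout)
set_option linter.dupNamespace false

noncomputable section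

namespace Summit.NavierStokesRegularity.NavierStokesRegularity.Theorems.ScenarioCensus

open Literature.Analysis

/-- Census sub-row S7a — (steady · `u^θ` AXISYMMETRIC (`IsAxisymmetricScalar (swirlVelocity U)`,
"`u^θ` independent of `θ`"; the full field need not be axisymmetric) · BOUNDED smooth steady
solutions on `ℝ³` (`IsLerayProfile ν 0 U P`, `U, P ∈ C^∞`, `∃ M, ∀ x, ‖U x‖ ≤ M`), any `ν > 0`,
axially `L`-periodic for some `L > 0`): `U ≡ c e₃`. Case (a) of Bang–Gui–Wang–Xie 2025 Thm 1.4,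
verbatim the binders of `Row_S7 = BangGuiWangXie2025_periodicSlab_liouville` with the first
disjunct as hypothesis (`row_S7a_of_row_S7`). -/
def Row_S7a : Prop :=
  ∀ ν : ℝ, 0 < ν → ∀ L : ℝ, 0 < L →
    ∀ (U : EuclideanSpace ℝ (Fin 3) → EuclideanSpace ℝ (Fin 3)) (P : EuclideanSpace ℝ (Fin 3) → ℝ),
      FluidPDE.IsLerayProfile ν 0 U P → ContDiff ℝ (⊤ : ℕ∞) U → ContDiff ℝ (⊤ : ℕ∞) P →
      (∃ M : ℝ, ∀ x, ‖U x‖ ≤ M) → FluidPDE.IsAxiallyPeriodic L U →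
        FluidPDE.IsAxisymmetricScalar (FluidPDE.swirlVelocity U) →
          ∃ c : ℝ, U = fun _ => c • FluidPDE.eZ

/-- Census sub-row S7b — (steady · `u^r` AXISYMMETRIC (`IsAxisymmetricScalar (radialVelocity U)`,
"`u^r` independent of `θ`") · BOUNDED smooth steady solutions on `ℝ³`, any `ν > 0`, axially
`L`-periodic for some `L > 0`): `U ≡ c e₃`. Case (b) of Bang–Gui–Wang–Xie 2025 Thm 1.4, verbatim
the binders of `Row_S7` with the second disjunct as hypothesis (`row_S7b_of_row_S7`). -/
def Row_S7b : Prop :=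
  ∀ ν : ℝ, 0 < ν → ∀ L : ℝ, 0 < L →
    ∀ (U : EuclideanSpace ℝ (Fin 3) → EuclideanSpace ℝ (Fin 3)) (P : EuclideanSpace ℝ (Fin 3) → ℝ),
      FluidPDE.IsLerayProfile ν 0 U P → ContDiff ℝ (⊤ : ℕ∞) U → ContDiff ℝ (⊤ : ℕ∞) P →
      (∃ M : ℝ, ∀ x, ‖U x‖ ≤ M) → FluidPDE.IsAxiallyPeriodic L U →
        FluidPDE.IsAxisymmetricScalar (FluidPDE.radialVelocity U) →
          ∃ c : ℝ, U = fun _ => c • FluidPDE.eZ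

/-- S7 ⇒ S7a (the first disjunct of the first conjunct of the printed theorem). -/
theorem row_S7a_of_row_S7 (h : Row_S7) : Row_S7a :=
  fun ν hν L hL U P hUP hU hP hbdd hper hsw => (h ν hν L hL U P hUP hU hP hbdd hper).1 (Or.inl hsw)

/-- S7 ⇒ S7b (the second disjunct of the first conjunct of the printed theorem). -/
theorem row_S7b_of_row_S7 (h : Row_S7) : Row_S7b :=
  fun ν hν L hL U P hUP hU hP hbdd hper hrad =>
    (h ν hν L hL U P hUP hU hP hbdd hper).1 (Or.inr (Or.inl hrad))

/-- **Census sub-row S7a is EXCLUDED-IN-TREE**: Bang–Gui–Wang–Xie 2025, Thm 1.4 (a), by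
`PeriodicSlab.periodicSlab_liouville_swirlAxisymmetric`. -/
theorem row_S7a_excluded : Row_S7a :=
  fun _ν hν _L hL _U _P hUP hU hP hbdd hper hsw =>
    PeriodicSlab.periodicSlab_liouville_swirlAxisymmetric hν hL hUP hU hP hbdd hper hsw

/-- **Census sub-row S7b is EXCLUDED-IN-TREE**: Bang–Gui–Wang–Xie 2025, Thm 1.4 (b), by
`PeriodicSlab.periodicSlab_liouville_radialAxisymmetric`. -/
theorem row_S7b_excluded : Row_S7b :=
  fun _ν hν _L hL _U _P hUP hU hP hbdd hper hrad =>
    PeriodicSlab.periodicSlab_liouville_radialAxisymmetric hν hL hUP hU hP hbdd hper hrad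

end Summit.NavierStokesRegularity.NavierStokesRegularity.Theorems.ScenarioCensus

end
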